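import Summits.AnomalousDissipation.AnomalousDissipation.Theses.MomentParity
import Summits.AnomalousDissipation.AnomalousDissipation.Theorems.MomentParityQuarticGateDesignRowSums
import Summits.AnomalousDissipation.AnomalousDissipation.Theorems.MomentParityQuarticGateAtomicMeasure
import Literature.Analysis.FluidPDE.BeltramiWavesCurl

/-!
# Stub S6 `stub_order2Design` of line `recession-cone` (crux `MomentParity.QuarticGate`)

The (mean, covariance) tier of the construction: ONE explicit Kolmogorov force
`f = cos(2πx₁) e₀` on the unit three-torus, budgets `E = 4`, `ε = 1/4`, `ν₀ = 10⁻³`, and for every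
`ν ∈ (0, ν₀)` and every level `N ≥ ⌈ν⁻¹⌉₊` the UNIFORM LAW `μ₀` on the `16 · #FrameIdx` atoms
`realTrigPoly S ĉ(m, a, s₁, s₂)` (`S = (freqBall N).erase 0`) of the explicit order-2 design of
`MomentParityQuarticGateDesignSums`:

* mean flow = force mode (`A₁ = 1 - 4π²ν`, `B₂ = 1/π`, so that the averaged Reynolds stress
  `πA₁B₂ f` balances `f + νΔf`): all LINEAR ROWS vanish (`design_sum_linearRow`);
* the dissipation carrier `c cos(2πN x₂) e₀` with `c` the explicit square root solving
  `ν · 4π² · (mean enstrophy) = (f, f) = 1/2`: the ENERGY ROW vanishes and the dissipation is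
  exactly `1/2 ≥ ε`, while `N²ν ≥ 1` keeps its energy `≤ 1/(8π²)`, so the mean energy is `≤ E`;
* linear polarisation of every mode and helicity conservation: the HELICITY ROW vanishes;
* the `±η`-frame noise: two atoms differing in the sign of `e_a` have pairings with a band test `g`
  differing by `2η (e_a, g)`, non-zero for some `a` unless `g = 0`: NONDEGENERATE COVARIANCE.
-/

namespace Summit.AnomalousDissipation.AnomalousDissipation.Theorems.MomentParityQuarticGate

open MeasureTheory Filter
open Literature.Analysis.FunctionSpaces Literature.Analysis.FluidPDE
open Summit.AnomalousDissipation.AnomalousDissipation.Theses.MomentParity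
open scoped InnerProductSpace RealInnerProductSpace ComplexConjugate ENNReal

set_option linter.dupNamespace false

/-- The tuning identity of the dissipation carrier: with `N²c²/2 = (8π²ν)⁻¹ - S - G/nA` the mean
dissipation `ν · (#ι)⁻¹ · 4π² · (#ι (S + N²c²/2) + 16 G)` equals `1/2` (`#ι = 16 nA`). [folklore] -/
theorem design_dissipation_identity (ν nA N q G S : ℝ) (hν : ν ≠ 0) (hnA : nA ≠ 0) (hN : N ≠ 0)
    (hq : q ≠ 0) :
    ν * ((16 * nA)⁻¹ * (4 * q ^ 2 * (16 * nA * (S + N ^ 2 * (2 / N ^ 2 * ((8 * q ^ 2 * ν)⁻¹ - S - G / nA)) / 2) +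
      16 * G))) = 1 / 2 := by
  field_simp
  ring

/-- The tuning identity of the dissipation carrier, energy-row form: injection `#ι/2` minus
`ν · 4π² ·` (total enstrophy) vanishes. [folklore] -/
theorem design_energyRow_identity (ν nA N q G S : ℝ) (hν : ν ≠ 0) (hnA : nA ≠ 0) (hN : N ≠ 0)
    (hq : q ≠ 0) :
    (16 * nA)⁻¹ * (16 * nA * (1 / 2) - ν * (4 * q ^ 2 * (16 * nA *
      (S + N ^ 2 * (2 / N ^ 2 * ((8 * q ^ 2 * ν)⁻¹ - S - G / nA)) / 2) + 16 * G))) = 0 := by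
  field_simp
  ring

/-- **S6 — THE ORDER-2 DESIGN, ONE EXPLICIT FORCE.** Kolmogorov force `f = cos(2πx₁)e₀`, `E = 4`,
`ε = 1/4`, `ν₀ = 10⁻³`; for `ν ∈ (0, ν₀)` and `N ≥ ⌈ν⁻¹⌉₊` the uniform law on the atoms of the
explicit design has all linear rows, the energy row and the helicity row exact, bounded support,
level `N`, nondegenerate covariance, mean energy `≤ E` and dissipation `= 1/2 ≥ ε`. [folklore] -/
theorem stub_order2Design :
    ∃ f : UnitAddTorus (Fin 3) → EuclideanSpace ℝ (Fin 3), Torus.IsSmooth f ∧ Torus.IsDivFree f ∧ Torus.HasZeroMean f ∧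
    ∃ E ε ν₀ : ℝ, 0 < ε ∧ 0 < ν₀ ∧ ∀ ν : ℝ, 0 < ν → ν < ν₀ → ∃ N₀ : ℕ, ∀ N : ℕ, N₀ ≤ N →
    ∃ μ₀ : Measure (Torus.energySpace (Fin 3)), IsProbabilityMeasure μ₀ ∧ (∀ᵐ u ∂μ₀, (∀ k ∉ (Torus.freqBall N).erase (0 : Fin 3 → ℤ),
          UnitAddTorus.mFourierCoeff (EuclideanSpace.complexify ∘ (u.1 : UnitAddTorus (Fin 3) → EuclideanSpace ℝ (Fin 3))) k = 0)) ∧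
    (∃ R : ℝ, ∀ᵐ u ∂μ₀, ‖u‖ ≤ R) ∧
    (∀ g : UnitAddTorus (Fin 3) → EuclideanSpace ℝ (Fin 3), (Torus.IsSmooth (g) ∧ Torus.IsDivFree (g) ∧ Torus.HasZeroMean (g) ∧
        ∀ k ∉ (Torus.freqBall N).erase (0 : Fin 3 → ℤ),
          UnitAddTorus.mFourierCoeff (EuclideanSpace.complexify ∘ (g)) k = 0) →
      (∃ u : Torus.energySpace (Fin 3), (∀ k ∉ (Torus.freqBall N).erase (0 : Fin 3 → ℤ),
          UnitAddTorus.mFourierCoeff (EuclideanSpace.complexify ∘ (u.1 : UnitAddTorus (Fin 3) → EuclideanSpace ℝ (Fin 3))) k = 0) ∧ Torus.pairing u.1 g ≠ 0) →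
      (∫ u : Torus.energySpace (Fin 3), Torus.pairing u.1 g ∂μ₀) ^ 2 < ∫ u : Torus.energySpace (Fin 3), (Torus.pairing u.1 g) ^ 2 ∂μ₀) ∧
    (∀ g : UnitAddTorus (Fin 3) → EuclideanSpace ℝ (Fin 3), (Torus.IsSmooth (g) ∧ Torus.IsDivFree (g) ∧ Torus.HasZeroMean (g) ∧
        ∀ k ∉ (Torus.freqBall N).erase (0 : Fin 3 → ℤ),
          UnitAddTorus.mFourierCoeff (EuclideanSpace.complexify ∘ (g)) k = 0) →
      Integrable (fun u : Torus.energySpace (Fin 3) => Torus.nsGeneratorPairing ν f u g) μ₀ ∧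
      ∫ u : Torus.energySpace (Fin 3), Torus.nsGeneratorPairing ν f u g ∂μ₀ = 0) ∧
    (Integrable (fun u : Torus.energySpace (Fin 3) => Torus.nsGeneratorPairing ν f u (Torus.fourierTruncate N (u.1 : UnitAddTorus (Fin 3) → EuclideanSpace ℝ (Fin 3)))) μ₀ ∧
      ∫ u : Torus.energySpace (Fin 3), Torus.nsGeneratorPairing ν f u (Torus.fourierTruncate N (u.1 : UnitAddTorus (Fin 3) → EuclideanSpace ℝ (Fin 3))) ∂μ₀ = 0) ∧
    (Integrable (fun u : Torus.energySpace (Fin 3) => Torus.nsGeneratorPairing ν f u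
        (BDSV.curl (Torus.fourierTruncate N (u.1 : UnitAddTorus (Fin 3) → EuclideanSpace ℝ (Fin 3))))) μ₀ ∧
      ∫ u : Torus.energySpace (Fin 3), Torus.nsGeneratorPairing ν f u (BDSV.curl (Torus.fourierTruncate N (u.1 : UnitAddTorus (Fin 3) → EuclideanSpace ℝ (Fin 3)))) ∂μ₀ = 0) ∧
    Torus.ensembleEnergy μ₀ ≤ E ∧ ε ≤ Torus.ensembleDissipation ν μ₀ := by
  classical
  have hπ3 : (3 : ℝ) < Real.pi := Real.pi_gt_three
  have hπ4 : Real.pi < 4 := Real.pi_lt_four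
  have hπ0 : Real.pi ≠ 0 := Real.pi_ne_zero
  refine ⟨(Torus.realTrigPoly {(![0, 1, 0] : Fin 3 → ℤ)} (fun _ => (1 : ℂ) • EuclideanSpace.complexify (WithLp.toLp 2 ![(1 : ℝ), 0, 0] : EuclideanSpace ℝ (Fin 3)))), Torus.isSmooth_realTrigPoly _ _, ?_, ?_, 4, 1 / 4, 1 / 1000, by norm_num, by norm_num, ?_⟩
  · exact Torus.isDivFree_realTrigPoly_singleton (by simp [Fin.sum_univ_three])
  · refine hasZeroMean_realTrigPoly_of_zero_not_mem (fun h => ?_) _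
    rw [Finset.mem_singleton] at h
    exact absurd (congrFun h 1) (by simp)
  intro ν hν hν₀
  refine ⟨⌈ν⁻¹⌉₊, fun N hN => ?_⟩
  -- the level
  have hν0 : ν ≠ 0 := hν.ne'
  have hNreal : ν⁻¹ ≤ (N : ℝ) := (Nat.le_ceil _).trans (by exact_mod_cast hN)
  have hν1000 : (1000 : ℝ) < ν⁻¹ := by
    rw [lt_inv_comm₀ (by norm_num) hν]; linarith only [hν₀]
  have hN2 : 2 ≤ N := by
    have : (2 : ℝ) ≤ N := by linarith only [hNreal, hν1000]
    exact_mod_cast this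
  have hNpos : (0 : ℝ) < N := by linarith only [hNreal, hν1000]
  have hN0 : (N : ℝ) ≠ 0 := hNpos.ne'
  have hN2ν : 1 ≤ (N : ℝ) ^ 2 * ν := by
    have h1 : 1 ≤ (N : ℝ) * ν := by
      have := mul_le_mul_of_nonneg_right hNreal hν.le
      rwa [inv_mul_cancel₀ hν0] at this
    have h2 : (1 : ℝ) ≤ N := by linarith only [hNreal, hν1000]
    nlinarith only [h1, h2, hν]
  -- the design constants
  obtain ⟨hkF, hnkF, -⟩ := design_mem hN2
  haveI : Nonempty (Torus.FrameIdx (Fin 3) N) := ⟨⟨⟨_, hkF⟩, 0, true⟩⟩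
  set A₁ : ℝ := 1 - 4 * Real.pi ^ 2 * ν with hA₁
  set B₂ : ℝ := Real.pi⁻¹ with hB₂
  set η : ℝ := ((N : ℝ) + 1)⁻¹ with hη
  have hη0 : η ≠ 0 := inv_ne_zero (by linarith only [hNpos])
  obtain ⟨cR, hcR⟩ : ∃ cR : Torus.FrameIdx (Fin 3) N → (Fin 3 → ℤ) → EuclideanSpace ℂ (Fin 3),
      cR = fun a : Torus.FrameIdx (Fin 3) N => (Pi.single (a.1 : Fin 3 → ℤ) ((((η / 2 : ℝ) : ℂ) * (if a.2.2 then (1 : ℂ) else -Complex.I)) • EuclideanSpace.complexify (Torus.perpVec (a.1 : Fin 3 → ℤ) a.2.1)) +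
        Pi.single (-(a.1 : Fin 3 → ℤ)) ((starRingEnd ℂ) (((η / 2 : ℝ) : ℂ) * (if a.2.2 then (1 : ℂ) else -Complex.I)) • EuclideanSpace.complexify (Torus.perpVec (a.1 : Fin 3 → ℤ) a.2.1)) : (Fin 3 → ℤ) → EuclideanSpace ℂ (Fin 3)) := ⟨_, rfl⟩
  set G : ℝ := ∑ a : Torus.FrameIdx (Fin 3) N,
    ∑ k ∈ ((Torus.freqBall N).erase 0), Torus.freqNormSq k * ‖(cR a) k‖ ^ 2 with hG
  set nA : ℝ := (Fintype.card (Torus.FrameIdx (Fin 3) N) : ℝ) with hnA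
  have hnA0 : 0 < nA := by rw [hnA]; exact_mod_cast Fintype.card_pos
  have hGle : G ≤ nA * ((N : ℝ) ^ 2 * η ^ 2 / 2) := design_sum_enstrophy_R_le hcR
  have hη1 : (N : ℝ) ^ 2 * η ^ 2 ≤ 1 := by
    rw [hη, inv_pow, ← div_eq_mul_inv, div_le_one (by positivity)]
    nlinarith only [hNpos]
  have hGnA : G / nA ≤ 1 / 2 := by
    rw [div_le_iff₀ hnA0]
    nlinarith only [hGle, hη1, hnA0]
  have hG0 : 0 ≤ G := Finset.sum_nonneg fun a _ => Finset.sum_nonneg fun k _ =>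
    mul_nonneg (Torus.freqNormSq_nonneg k) (sq_nonneg _)
  have hA₁1 : A₁ ^ 2 ≤ 1 := by
    have h1 : 0 ≤ A₁ := by rw [hA₁]; nlinarith only [hπ3, hπ4, hν, hν₀]
    have h2 : A₁ ≤ 1 := by rw [hA₁]; nlinarith only [Real.pi_pos, hν]
    nlinarith only [h1, h2]
  have hB₂1 : B₂ ^ 2 ≤ 1 / 9 := by
    rw [hB₂, inv_pow, ← one_div, div_le_div_iff₀ (by positivity) (by norm_num)]
    nlinarith only [hπ3]
  have h8 : 8 * Real.pi ^ 2 * ν ≤ 128 / 1000 := by nlinarith only [Real.pi_pos, hπ4, hν, hν₀]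
  have hinv7 : 7 ≤ (8 * Real.pi ^ 2 * ν)⁻¹ := by
    rw [le_inv_comm₀ (by norm_num) (by positivity)]; linarith only [h8]
  set X : ℝ := 2 / (N : ℝ) ^ 2 * ((8 * Real.pi ^ 2 * ν)⁻¹ - (1 / 2 + A₁ ^ 2 / 2 + 2 * B₂ ^ 2) - G / nA) with hX
  have hXin : 0 ≤ (8 * Real.pi ^ 2 * ν)⁻¹ - (1 / 2 + A₁ ^ 2 / 2 + 2 * B₂ ^ 2) - G / nA := by
    linarith only [hinv7, hA₁1, hB₂1, hGnA]
  have hX0 : 0 ≤ X := by rw [hX]; exact mul_nonneg (by positivity) hXin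
  set c : ℝ := Real.sqrt X with hc
  have hc2 : c ^ 2 = X := Real.sq_sqrt hX0
  obtain ⟨cf, hcf⟩ : ∃ cf : (Fin 3 → ℤ) → EuclideanSpace ℂ (Fin 3), cf = (Pi.single (![0, 1, 0] : Fin 3 → ℤ) (((1 / 2 : ℂ)) • EuclideanSpace.complexify (WithLp.toLp 2 ![(1 : ℝ), 0, 0] : EuclideanSpace ℝ (Fin 3))) +
        Pi.single (-(![0, 1, 0] : Fin 3 → ℤ)) ((starRingEnd ℂ) ((1 / 2 : ℂ)) • EuclideanSpace.complexify (WithLp.toLp 2 ![(1 : ℝ), 0, 0] : EuclideanSpace ℝ (Fin 3))) : (Fin 3 → ℤ) → EuclideanSpace ℂ (Fin 3)) := ⟨_, rfl⟩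
  obtain ⟨cA, hcA⟩ : ∃ cA : Fin 4 → (Fin 3 → ℤ) → EuclideanSpace ℂ (Fin 3), cA = fun m : Fin 4 => (Pi.single (![0, 0, 1] : Fin 3 → ℤ) ((((A₁ / 2 : ℝ) : ℂ) * Complex.I ^ (m : ℕ)) • EuclideanSpace.complexify (WithLp.toLp 2 ![(1 : ℝ), 0, 0] : EuclideanSpace ℝ (Fin 3))) +
        Pi.single (-(![0, 0, 1] : Fin 3 → ℤ)) ((starRingEnd ℂ) (((A₁ / 2 : ℝ) : ℂ) * Complex.I ^ (m : ℕ)) • EuclideanSpace.complexify (WithLp.toLp 2 ![(1 : ℝ), 0, 0] : EuclideanSpace ℝ (Fin 3))) : (Fin 3 → ℤ) → EuclideanSpace ℂ (Fin 3)) := ⟨_, rfl⟩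
  obtain ⟨cB, hcB⟩ : ∃ cB : Fin 4 → (Fin 3 → ℤ) → EuclideanSpace ℂ (Fin 3), cB = fun m : Fin 4 => (Pi.single (![0, 1, 1] : Fin 3 → ℤ) ((((B₂ / 2 : ℝ) : ℂ) * -Complex.I * Complex.I ^ (m : ℕ)) • EuclideanSpace.complexify (WithLp.toLp 2 ![(0 : ℝ), 1, -1] : EuclideanSpace ℝ (Fin 3))) +
        Pi.single (-(![0, 1, 1] : Fin 3 → ℤ)) ((starRingEnd ℂ) (((B₂ / 2 : ℝ) : ℂ) * -Complex.I * Complex.I ^ (m : ℕ)) • EuclideanSpace.complexify (WithLp.toLp 2 ![(0 : ℝ), 1, -1] : EuclideanSpace ℝ (Fin 3))) : (Fin 3 → ℤ) → EuclideanSpace ℂ (Fin 3)) := ⟨_, rfl⟩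
  obtain ⟨cC, hcC⟩ : ∃ cC : (Fin 3 → ℤ) → EuclideanSpace ℂ (Fin 3), cC = (Pi.single (![0, 0, (N : ℤ)] : Fin 3 → ℤ) ((((c / 2 : ℝ) : ℂ)) • EuclideanSpace.complexify (WithLp.toLp 2 ![(1 : ℝ), 0, 0] : EuclideanSpace ℝ (Fin 3))) +
        Pi.single (-(![0, 0, (N : ℤ)] : Fin 3 → ℤ)) ((starRingEnd ℂ) (((c / 2 : ℝ) : ℂ)) • EuclideanSpace.complexify (WithLp.toLp 2 ![(1 : ℝ), 0, 0] : EuclideanSpace ℝ (Fin 3))) : (Fin 3 → ℤ) → EuclideanSpace ℂ (Fin 3)) := ⟨_, rfl⟩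
  -- the atoms and the law
  choose U hU using fun p : (Fin 4 × Torus.FrameIdx (Fin 3) N × Bool × Bool) =>
    exists_energySpace_coe_ae_eq_realTrigPoly N _ (design_isTransversal hcf hcA hcB hcC hcR p)
  haveI : Nonempty (Fin 4 × Torus.FrameIdx (Fin 3) N × Bool × Bool) := ⟨(0, Classical.arbitrary _, true, true)⟩
  have hcard : ((Fintype.card (Fin 4 × Torus.FrameIdx (Fin 3) N × Bool × Bool) : ℕ) : ℝ) = 16 * nA := by
    rw [hnA, Fintype.card_prod (Fin 4), Fintype.card_prod (Torus.FrameIdx (Fin 3) N), Fintype.card_prod Bool Bool,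
      Fintype.card_bool, Fintype.card_fin]
    push_cast
    ring
  have hcard0 : ((Fintype.card (Fin 4 × Torus.FrameIdx (Fin 3) N × Bool × Bool) : ℕ) : ℝ) ≠ 0 := by rw [hcard]; positivity
  refine ⟨((Fintype.card (Fin 4 × Torus.FrameIdx (Fin 3) N × Bool × Bool) : ℕ) : ℝ≥0∞)⁻¹ • ∑ p, Measure.dirac (U p),
    isProbabilityMeasure_average U, ae_average U fun p => design_level hcf hcA hcB hcC hcR hU p,
    ⟨_, ae_norm_le_average U⟩, ?_, ?_, ?_, ?_, ?_, ?_⟩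
  · -- nondegenerate covariance
    rintro g ⟨hg, hgd, hgm, hgb⟩ ⟨u, -, hu⟩
    obtain ⟨a, ha⟩ := exists_frame_pairing_ne_zero N hg hgd hgm hgb ⟨u, hu⟩
    refine sq_integral_lt_integral_sq_average U (fun u => Torus.pairing u.1 g)
      ⟨((0 : Fin 4), a, true, true), ((0 : Fin 4), a, true, false), fun heq => ha ?_⟩
    have hflip := design_pairing_flip hcR hU 0 a true hg
    rw [heq, sub_self] at hflip
    have : (2 * η) * ∫ x, ⟪Torus.frameFieldIdx N a x, g x⟫_ℝ = 0 := hflip.symm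
    exact (mul_eq_zero.1 this).resolve_left (mul_ne_zero two_ne_zero hη0)
  · -- linear rows
    rintro g ⟨hg, -, -, hgb⟩
    refine ⟨integrable_average U _, ?_⟩
    rw [integral_average, design_sum_linearRow hcf hcA hcB hcC hcR hU hN2 ν hg hgb]
    have : 1 - 4 * Real.pi ^ 2 * ν - Real.pi * A₁ * B₂ = 0 := by
      rw [hA₁, hB₂]; field_simp; ring
    rw [this, mul_zero, zero_mul, mul_zero]
  · -- energy row
    refine ⟨integrable_average U _, ?_⟩
    rw [integral_average, design_sum_energyRow hcf hcA hcB hcC hcR hU hN2 ν, ← hG, hcard, hc2, hX]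
    exact design_energyRow_identity ν nA N Real.pi G (1 / 2 + A₁ ^ 2 / 2 + 2 * B₂ ^ 2) hν0 hnA0.ne' hN0 hπ0
  · -- helicity row
    refine ⟨integrable_average U _, ?_⟩
    rw [integral_average, design_sum_helicityRow hcf hcA hcB hcC hcR hU hN2 ν, mul_zero]
  · -- mean energy
    rw [ensembleEnergy_average]
    have h := design_sum_norm_sq_le hcf hcA hcB hcC hcR hU hN2
    have hc2le : c ^ 2 / 2 ≤ 1 := by
      rw [hc2, hX]
      have h1 : (8 * Real.pi ^ 2 * ν)⁻¹ - (1 / 2 + A₁ ^ 2 / 2 + 2 * B₂ ^ 2) - G / nA ≤ (8 * Real.pi ^ 2 * ν)⁻¹ := by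
        nlinarith only [div_nonneg hG0 hnA0.le, sq_nonneg A₁, sq_nonneg B₂]
      have h2 : (8 * Real.pi ^ 2 * ν)⁻¹ ≤ (N : ℝ) ^ 2 := by
        rw [inv_le_comm₀ (by positivity) (by positivity)]
        have h1N : (1 : ℝ) ≤ N := by linarith only [hNreal, hν1000]
        have h8π : (1 : ℝ) ≤ 8 * Real.pi ^ 2 := by nlinarith only [hπ3]
        calc ((N : ℝ) ^ 2)⁻¹ ≤ ν := by
              rw [inv_le_comm₀ (by positivity) hν]
              exact hNreal.trans (by nlinarith only [h1N])
          _ = 1 * ν := (one_mul ν).symm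
          _ ≤ 8 * Real.pi ^ 2 * ν := mul_le_mul_of_nonneg_right h8π hν.le
      calc 2 / (N : ℝ) ^ 2 * ((8 * Real.pi ^ 2 * ν)⁻¹ - (1 / 2 + A₁ ^ 2 / 2 + 2 * B₂ ^ 2) - G / nA) / 2
          ≤ 2 / (N : ℝ) ^ 2 * (N : ℝ) ^ 2 / 2 := by gcongr; exact h1.trans h2
        _ = 1 := by field_simp
    have hη2 : η ^ 2 / 2 ≤ 1 := by
      have h1 : η ≤ 1 := by rw [hη]; exact inv_le_one_of_one_le₀ (by linarith only [hNpos])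
      have h2 : 0 ≤ η := by rw [hη]; positivity
      nlinarith only [h1, h2]
    calc ((Fintype.card (Fin 4 × Torus.FrameIdx (Fin 3) N × Bool × Bool) : ℕ) : ℝ)⁻¹ * ∑ p, ‖U p‖ ^ 2
        ≤ ((Fintype.card (Fin 4 × Torus.FrameIdx (Fin 3) N × Bool × Bool) : ℕ) : ℝ)⁻¹ *
            (((Fintype.card (Fin 4 × Torus.FrameIdx (Fin 3) N × Bool × Bool) : ℕ) : ℝ) * (1 / 2 + A₁ ^ 2 / 2 + B₂ ^ 2 + c ^ 2 / 2 + η ^ 2 / 2)) :=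
          mul_le_mul_of_nonneg_left h (by positivity)
      _ = 1 / 2 + A₁ ^ 2 / 2 + B₂ ^ 2 + c ^ 2 / 2 + η ^ 2 / 2 := by rw [← mul_assoc, inv_mul_cancel₀ hcard0, one_mul]
      _ ≤ 4 := by linarith only [hA₁1, hB₂1, hc2le, hη2]
  · -- dissipation
    rw [ensembleDissipation_average U ν (e := fun p : (Fin 4 × Torus.FrameIdx (Fin 3) N × Bool × Bool) =>
        4 * Real.pi ^ 2 * ∑ k ∈ ((Torus.freqBall N).erase 0), Torus.freqNormSq k * ‖(cf + cA p.1 + cB p.1 + (if p.2.2.1 then (1 : ℝ) else -1) • cC + (if p.2.2.2 then (1 : ℝ) else -1) • cR p.2.1) k‖ ^ 2)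
      (fun p => mul_nonneg (by positivity) (Finset.sum_nonneg fun k _ =>
        mul_nonneg (Torus.freqNormSq_nonneg k) (sq_nonneg _)))
      (fun p => design_eGradNormSq hcf hcA hcB hcC hcR hU p),
      ← Finset.mul_sum, design_sum_enstrophy hcf hcA hcB hcC hN2, ← hG, hcard, hc2, hX]
    rw [design_dissipation_identity ν nA N Real.pi G (1 / 2 + A₁ ^ 2 / 2 + 2 * B₂ ^ 2) hν0 hnA0.ne' hN0 hπ0]
    norm_num

end Summit.AnomalousDissipation.AnomalousDissipation.Theorems.MomentParityQuarticGate
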